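import Summits.AtomisticToContinuum.HydrodynamicLimit.Theorems.LambertianContactSwapContactAngleEquidistributionEqCentring
import Literature.MathematicalPhysics.KineticTheory.HardSphereCanonicalKSLimit
import HarnessLib

/-!
# The static sandwich of the equilibrium crux (stub `stub_eqCruxSandwich`, line `Sketch` v5,
# crux `LambertianContactSwap.ContactAngleEquidistribution`, stmt-AtomisticToContinuum-12097; lead c2)

After Campbell (`stub_campbellTimeDep`), the midpoint bookkeeping (`stub_eqFluxMidSum`) and the spectator
integration (`stub_eqStaticFlux`), the equilibrium mean of the crux functional at instant `s` is a multiple of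
`Stat(Ψ) = ∫dx ∫dv ∫dw ∫_{S²}dω (ε²⟪ω, w − v⟫)₊ M(v)M(w) Ψ(x,v,w,ω) · vcan ε (N+1) (dumbbell x ω)` at the
positive / negative parts `Ψ^±` of the `κ_g`-centred mark. Here: `Stat(Ψ⁺) ≤ Stat(Ψ⁻) + 4δε²K` and conversely,
whenever the dumbbell correlation is within `δ` of a constant `g₀ ≥ 0` uniformly (`stub_eqDumbbellLimit`) and
the angular cubic Gaussian flux moment is `≤ K` (`stub_eqFluxMoment`): with the constant in place of `vcan` the
two functionals coincide by the fibrewise centring identity (`fibre_lintegral_cosFlux_mark_pos_eq_neg`). Tools: an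
abstract sandwich on a measure space, Tonelli between the four-fold iterated integral and the product measure,
measurability of the factors. Reference: Cercignani–Illner–Pulvirenti (1994), App. 4.A.
-/


noncomputable section

open MeasureTheory Filter Set Topology ProbabilityTheory
open scoped ENNReal BigOperators Classical RealInnerProductSpace

namespace Summit.AtomisticToContinuum.HydrodynamicLimit.Theorems.ContactAngleEquidistributionSketch

open Literature.Analysis.FluidPDE Literature.MathematicalPhysics.KineticTheory

namespace EqCrux

/-! ### An abstract sandwich -/

/-- **Abstract sandwich, one direction.** If `|V − g₀| ≤ δ` pointwise (`g₀, δ ≥ 0`), `W Ψ⁺`, `W Ψ⁻`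
are measurable with the same integral, which is `≤ B`, then `∫ WΨ⁺V ≤ ∫ WΨ⁻V + 2δB` and `∫ WΨ⁺V ≤ (g₀+δ)B`.
[folklore] -/
theorem sandwich_one {α : Type*} [MeasurableSpace α] (μ : Measure α) {W Ψp Ψm : α → ℝ≥0∞} {V : α → ℝ}
    {g₀ δ : ℝ} {B : ℝ≥0∞} (hg₀ : 0 ≤ g₀) (hδ : 0 ≤ δ) (hV : ∀ a, |V a - g₀| ≤ δ)
    (hp : Measurable fun a => W a * Ψp a) (hm : Measurable fun a => W a * Ψm a)
    (hcen : ∫⁻ a, W a * Ψp a ∂μ = ∫⁻ a, W a * Ψm a ∂μ) (hB : ∫⁻ a, W a * Ψp a ∂μ ≤ B) :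
    (∫⁻ a, W a * Ψp a * ENNReal.ofReal (V a) ∂μ ≤
        ∫⁻ a, W a * Ψm a * ENNReal.ofReal (V a) ∂μ + ENNReal.ofReal (2 * δ) * B) ∧
      (∫⁻ a, W a * Ψp a * ENNReal.ofReal (V a) ∂μ ≤ ENNReal.ofReal (g₀ + δ) * B) := by
  have h1 : ∀ a, ENNReal.ofReal (V a) ≤ ENNReal.ofReal g₀ + ENNReal.ofReal δ := fun a => by
    rw [← ENNReal.ofReal_add hg₀ hδ]
    exact ENNReal.ofReal_le_ofReal (by linarith [(abs_le.1 (hV a)).2])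
  have h2 : ∀ a, ENNReal.ofReal g₀ ≤ ENNReal.ofReal (V a) + ENNReal.ofReal δ := fun a => by
    calc ENNReal.ofReal g₀ ≤ ENNReal.ofReal (V a + δ) :=
          ENNReal.ofReal_le_ofReal (by linarith [(abs_le.1 (hV a)).1])
      _ ≤ ENNReal.ofReal (V a) + ENNReal.ofReal δ := ENNReal.ofReal_add_le
  have upper : ∫⁻ a, W a * Ψp a * ENNReal.ofReal (V a) ∂μ ≤
      (∫⁻ a, W a * Ψp a ∂μ) * ENNReal.ofReal g₀ + (∫⁻ a, W a * Ψp a ∂μ) * ENNReal.ofReal δ := by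
    calc ∫⁻ a, W a * Ψp a * ENNReal.ofReal (V a) ∂μ
        ≤ ∫⁻ a, (W a * Ψp a * ENNReal.ofReal g₀ + W a * Ψp a * ENNReal.ofReal δ) ∂μ :=
          lintegral_mono fun a => by rw [← mul_add]; exact mul_le_mul' le_rfl (h1 a)
      _ = ∫⁻ a, W a * Ψp a * ENNReal.ofReal g₀ ∂μ + ∫⁻ a, W a * Ψp a * ENNReal.ofReal δ ∂μ :=
          lintegral_add_left (hp.mul_const _) _
      _ = _ := by rw [lintegral_mul_const _ hp, lintegral_mul_const _ hp]
  have lower : (∫⁻ a, W a * Ψm a ∂μ) * ENNReal.ofReal g₀ ≤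
      ∫⁻ a, W a * Ψm a * ENNReal.ofReal (V a) ∂μ + (∫⁻ a, W a * Ψm a ∂μ) * ENNReal.ofReal δ := by
    calc (∫⁻ a, W a * Ψm a ∂μ) * ENNReal.ofReal g₀ = ∫⁻ a, W a * Ψm a * ENNReal.ofReal g₀ ∂μ :=
          (lintegral_mul_const _ hm).symm
      _ ≤ ∫⁻ a, (W a * Ψm a * ENNReal.ofReal (V a) + W a * Ψm a * ENNReal.ofReal δ) ∂μ :=
          lintegral_mono fun a => by rw [← mul_add]; exact mul_le_mul' le_rfl (h2 a)
      _ = ∫⁻ a, W a * Ψm a * ENNReal.ofReal (V a) ∂μ + ∫⁻ a, W a * Ψm a * ENNReal.ofReal δ ∂μ :=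
          lintegral_add_right _ (hm.mul_const _)
      _ = _ := by rw [lintegral_mul_const _ hm]
  have hBm : ∫⁻ a, W a * Ψm a ∂μ ≤ B := hcen ▸ hB
  refine ⟨?_, ?_⟩
  · calc ∫⁻ a, W a * Ψp a * ENNReal.ofReal (V a) ∂μ
        ≤ (∫⁻ a, W a * Ψm a ∂μ) * ENNReal.ofReal g₀ + (∫⁻ a, W a * Ψp a ∂μ) * ENNReal.ofReal δ := by
          rw [← hcen]; exact upper
      _ ≤ (∫⁻ a, W a * Ψm a * ENNReal.ofReal (V a) ∂μ + (∫⁻ a, W a * Ψm a ∂μ) * ENNReal.ofReal δ) +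
            (∫⁻ a, W a * Ψp a ∂μ) * ENNReal.ofReal δ := add_le_add lower le_rfl
      _ ≤ ∫⁻ a, W a * Ψm a * ENNReal.ofReal (V a) ∂μ + ENNReal.ofReal (2 * δ) * B := by
          rw [two_mul, ENNReal.ofReal_add hδ hδ, add_mul, add_assoc]
          refine add_le_add le_rfl (add_le_add ?_ ?_)
          · rw [mul_comm]; exact mul_le_mul' le_rfl hBm
          · rw [mul_comm]; exact mul_le_mul' le_rfl hB
  · calc ∫⁻ a, W a * Ψp a * ENNReal.ofReal (V a) ∂μ
        ≤ (∫⁻ a, W a * Ψp a ∂μ) * ENNReal.ofReal g₀ + (∫⁻ a, W a * Ψp a ∂μ) * ENNReal.ofReal δ := upper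
      _ ≤ ENNReal.ofReal (g₀ + δ) * B := by
          rw [ENNReal.ofReal_add hg₀ hδ, add_mul, mul_comm _ (ENNReal.ofReal g₀),
            mul_comm _ (ENNReal.ofReal δ)]
          exact add_le_add (mul_le_mul' le_rfl hB) (mul_le_mul' le_rfl hB)

/-- **Abstract sandwich** (both directions and both crude bounds). [folklore] -/
theorem sandwich {α : Type*} [MeasurableSpace α] (μ : Measure α) {W Ψp Ψm : α → ℝ≥0∞} {V : α → ℝ}
    {g₀ δ : ℝ} {B : ℝ≥0∞} (hg₀ : 0 ≤ g₀) (hδ : 0 ≤ δ) (hV : ∀ a, |V a - g₀| ≤ δ)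
    (hp : Measurable fun a => W a * Ψp a) (hm : Measurable fun a => W a * Ψm a)
    (hcen : ∫⁻ a, W a * Ψp a ∂μ = ∫⁻ a, W a * Ψm a ∂μ) (hB : ∫⁻ a, W a * Ψp a ∂μ ≤ B) :
    (∫⁻ a, W a * Ψp a * ENNReal.ofReal (V a) ∂μ ≤
        ∫⁻ a, W a * Ψm a * ENNReal.ofReal (V a) ∂μ + ENNReal.ofReal (2 * δ) * B) ∧
      (∫⁻ a, W a * Ψm a * ENNReal.ofReal (V a) ∂μ ≤
        ∫⁻ a, W a * Ψp a * ENNReal.ofReal (V a) ∂μ + ENNReal.ofReal (2 * δ) * B) ∧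
      (∫⁻ a, W a * Ψp a * ENNReal.ofReal (V a) ∂μ ≤ ENNReal.ofReal (g₀ + δ) * B) ∧
      (∫⁻ a, W a * Ψm a * ENNReal.ofReal (V a) ∂μ ≤ ENNReal.ofReal (g₀ + δ) * B) :=
  have h₁ := sandwich_one μ hg₀ hδ hV hp hm hcen hB
  have h₂ := sandwich_one μ hg₀ hδ hV hm hp hcen.symm (hcen ▸ hB)
  ⟨h₁.1, h₂.1, h₁.2, h₂.2⟩

/-! ### Four-fold iterated integrals and small facts -/

/-- `ofReal` ignores the positive-part truncation (private copy; the same one-liner is landed under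
`…Crystallization.Theorems.UnimodularEnergy`, whose module imports all of Mathlib). [folklore] -/
private theorem ofReal_max_zero (r : ℝ) : ENNReal.ofReal (max r 0) = ENNReal.ofReal r := by
  rcases le_total r 0 with h | h
  · rw [max_eq_right h, ENNReal.ofReal_zero, ENNReal.ofReal_of_nonpos h]
  · rw [max_eq_left h]

/-- The four-fold iterated integral is the integral against the product measure (Tonelli). [folklore] -/
theorem lintegral_iter4_eq_prod {f : T3 × V3 × V3 × Metric.sphere (0 : V3) 1 → ℝ≥0∞}
    (hf : Measurable f) :
    ∫⁻ x : T3, ∫⁻ v : V3, ∫⁻ w : V3, ∫⁻ ω : Metric.sphere (0 : V3) 1, f (x, v, w, ω)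
        ∂(volume : Measure V3).toSphere =
      ∫⁻ p, f p ∂((volume : Measure T3).prod ((volume : Measure V3).prod
        ((volume : Measure V3).prod (volume : Measure V3).toSphere))) := by
  haveI : SFinite ((volume : Measure V3).toSphere) := inferInstance
  haveI : SFinite ((volume : Measure V3).prod (volume : Measure V3).toSphere) := inferInstance
  haveI : SFinite ((volume : Measure V3).prod ((volume : Measure V3).prod
      (volume : Measure V3).toSphere)) := inferInstance
  rw [lintegral_prod _ hf.aemeasurable]
  refine lintegral_congr fun x => ?_
  have hfx : Measurable fun y : V3 × V3 × Metric.sphere (0 : V3) 1 => f (x, y) :=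
    hf.comp measurable_prodMk_left
  rw [lintegral_prod (fun y => f (x, y)) hfx.aemeasurable]
  refine lintegral_congr fun v => ?_
  have hfxv : Measurable fun y : V3 × Metric.sphere (0 : V3) 1 => f (x, v, y) :=
    hfx.comp measurable_prodMk_left
  rw [lintegral_prod (fun y => f (x, v, y)) hfxv.aemeasurable]

/-- A constant integrates to itself over the torus (Haar probability). [folklore] -/
theorem lintegral_T3_const (c : ℝ≥0∞) : ∫⁻ _ : T3, c = c := by
  rw [lintegral_const, measure_univ, mul_one]

/-- Measurability of the flux weight `(ε^k ⟪ω, w − v⟫)₊ M(v) M(w)` on (midpoint, `v`, `w`, normal). [folklore] -/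
theorem measurable_fluxWeight (a θ : ℝ) :
    Measurable fun p : T3 × V3 × V3 × Metric.sphere (0 : V3) 1 =>
      ENNReal.ofReal (a * ⟪((p.2.2.2 : V3)), p.2.2.1 - p.2.1⟫) *
        ENNReal.ofReal (localMaxwellian 1 θ 0 p.2.1 * localMaxwellian 1 θ 0 p.2.2.1) := by
  have hω : Continuous fun p : T3 × V3 × V3 × Metric.sphere (0 : V3) 1 => (p.2.2.2 : V3) :=
    continuous_subtype_val.comp (continuous_snd.comp (continuous_snd.comp continuous_snd))
  have hv : Continuous fun p : T3 × V3 × V3 × Metric.sphere (0 : V3) 1 => p.2.1 :=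
    continuous_fst.comp continuous_snd
  have hw : Continuous fun p : T3 × V3 × V3 × Metric.sphere (0 : V3) 1 => p.2.2.1 :=
    continuous_fst.comp (continuous_snd.comp continuous_snd)
  have h1 : Continuous fun p : T3 × V3 × V3 × Metric.sphere (0 : V3) 1 =>
      a * ⟪((p.2.2.2 : V3)), p.2.2.1 - p.2.1⟫ := continuous_const.mul (hω.inner (hw.sub hv))
  have h2 : Continuous fun p : T3 × V3 × V3 × Metric.sphere (0 : V3) 1 =>
      localMaxwellian 1 θ 0 p.2.1 * localMaxwellian 1 θ 0 p.2.2.1 :=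
    ((continuous_localMaxwellian 1 θ (0 : V3)).comp hv).mul ((continuous_localMaxwellian 1 θ (0 : V3)).comp hw)
  exact h1.measurable.ennreal_ofReal.mul h2.measurable.ennreal_ofReal

/-- Measurability of the contact-dumbbell correlation `vcan ε n (x + (ε/2)ω, x − (ε/2)ω)`. [folklore] -/
theorem measurable_vcan_dumbbell (ε : ℝ) (n : ℕ) :
    Measurable fun p : T3 × V3 × V3 × Metric.sphere (0 : V3) 1 =>
      vcan ε n ![p.1 + Literature.Analysis.FunctionSpaces.Torus.proj ((ε / 2) • (p.2.2.2 : V3)),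
        p.1 + Literature.Analysis.FunctionSpaces.Torus.proj (-((ε / 2) • (p.2.2.2 : V3)))] := by
  have hω : Measurable fun p : T3 × V3 × V3 × Metric.sphere (0 : V3) 1 => (p.2.2.2 : V3) :=
    (continuous_subtype_val.comp (continuous_snd.comp (continuous_snd.comp continuous_snd))).measurable
  have hproj := Literature.Analysis.FunctionSpaces.Torus.measurable_proj (d := Fin 3)
  have ha : Measurable fun p : T3 × V3 × V3 × Metric.sphere (0 : V3) 1 =>
      p.1 + Literature.Analysis.FunctionSpaces.Torus.proj ((ε / 2) • (p.2.2.2 : V3)) :=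
    measurable_fst.add (hproj.comp ((measurable_const_smul (ε / 2)).comp hω))
  have hb : Measurable fun p : T3 × V3 × V3 × Metric.sphere (0 : V3) 1 =>
      p.1 + Literature.Analysis.FunctionSpaces.Torus.proj (-((ε / 2) • (p.2.2.2 : V3))) :=
    measurable_fst.add (hproj.comp ((measurable_const_smul (ε / 2)).comp hω).neg)
  refine measurable_vcan_comp ε n (measurable_pi_lambda _ fun k => ?_)
  fin_cases k
  · simpa using ha
  · simpa using hb

/-- Measurability of the signed (`c`) part of the `κ_g`-centred `|g|²`-weighted mark at instant `s`. [folklore] -/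
theorem measurable_markPart {ψ : ℝ → T3 → V3 → V3 → V3 → ℝ}
    (hψ : Measurable fun p : ℝ × T3 × V3 × V3 × V3 => ψ p.1 p.2.1 p.2.2.1 p.2.2.2.1 p.2.2.2.2)
    (s c : ℝ) :
    Measurable fun p : T3 × V3 × V3 × Metric.sphere (0 : V3) 1 =>
      ENNReal.ofReal (max (c * (‖p.2.1 - p.2.2.1‖ ^ 2 *
        (ψ s p.1 p.2.1 p.2.2.1 p.2.2.2 -
          ∫ ξ, ψ s p.1 p.2.1 p.2.2.1
            (‖‖-(p.2.1 - p.2.2.1)‖⁻¹ • (-(p.2.1 - p.2.2.1)) + ‖ξ‖⁻¹ • ξ‖⁻¹ •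
              (‖-(p.2.1 - p.2.2.1)‖⁻¹ • (-(p.2.1 - p.2.2.1)) + ‖ξ‖⁻¹ • ξ)) ∂(stdGaussian V3)))) 0) := by
  have hω : Measurable fun p : T3 × V3 × V3 × Metric.sphere (0 : V3) 1 => (p.2.2.2 : V3) :=
    (continuous_subtype_val.comp (continuous_snd.comp (continuous_snd.comp continuous_snd))).measurable
  have hv : Measurable fun p : T3 × V3 × V3 × Metric.sphere (0 : V3) 1 => p.2.1 :=
    measurable_fst.comp measurable_snd
  have hw : Measurable fun p : T3 × V3 × V3 × Metric.sphere (0 : V3) 1 => p.2.2.1 :=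
    measurable_fst.comp (measurable_snd.comp measurable_snd)
  have h1 := NearField.measurable_psiAt hψ (measurable_const (a := s)) measurable_fst hv hw hω
  have h2 := NearField.measurable_cosineMean hψ (measurable_const (a := s)) measurable_fst hv hw (hv.sub hw)
  exact ((measurable_const.mul (((hv.sub hw).norm.pow_const 2).mul (h1.sub h2))).max
    measurable_const).ennreal_ofReal

/-! ### The sandwich for the crux's mark -/

/-- **Registered sub-goal `stub_eqCruxSandwich`** (line `Sketch` v5, crux ContactAngleEquidistribution,
stmt-AtomisticToContinuum-12097): THE STATIC SANDWICH. Fix `σ > 0`, `θ`, `N`, an admissible `ψ` (jointly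
measurable, `|ψ| ≤ 1`), an instant `s`, and constants `g₀, δ ≥ 0`, `K` such that the contact-dumbbell correlation
`vcan ε_N (N+1) (x ± (ε_N/2)ω)` is within `δ` of `g₀` for all midpoints `x` and unit normals `ω`, and the angular
cubic Gaussian flux moment is at most `K`. Then the static functionals
`Stat(Ψ^±) = ∫dx ∫dv ∫dw ∫_{S²}dω (ε²⟪ω, w − v⟫)₊ M(v)M(w) Ψ^±(x,v,w,ω) vcan(dumbbell x ω)` of the positive and
negative parts `Ψ^±` of the centred mark `|v − w|²(ψ(s,x,v,w,ω) − ∫ ψ(s,x,v,w,n) κ_{v−w}(dn))` satisfy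
`Stat(Ψ⁺) ≤ Stat(Ψ⁻) + 4δε²K`, `Stat(Ψ⁻) ≤ Stat(Ψ⁺) + 4δε²K`, and both are `≤ (g₀ + δ)·2ε²K`: with `g₀` in
place of `vcan` the two functionals agree fibre by fibre (`fibre_lintegral_cosFlux_mark_pos_eq_neg`), and
`|Ψ^±| ≤ 2|v − w|²`. [cite: CIP1994, App. 4.A pp. 107–111] -/
theorem stub_eqCruxSandwich {σ : ℝ} (hσ : 0 < σ) (θ : ℝ) (N : ℕ)
    (ψ : ℕ → ℝ → T3 → V3 → V3 → V3 → ℝ)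
    (hψm : ∀ N, Measurable (fun p : ℝ × T3 × V3 × V3 × V3 =>
      ψ N p.1 p.2.1 p.2.2.1 p.2.2.2.1 p.2.2.2.2))
    (hψb : ∀ N s x v w n, |ψ N s x v w n| ≤ 1) (s : ℝ) {g₀ δ K : ℝ} (hg₀ : 0 ≤ g₀) (hδ : 0 ≤ δ)
    (hV : ∀ (x : T3) (ω : V3), ‖ω‖ = 1 →
      |vcan (hsDiameter σ N) (N + 1)
          ![x + Literature.Analysis.FunctionSpaces.Torus.proj ((hsDiameter σ N / 2) • ω),
            x + Literature.Analysis.FunctionSpaces.Torus.proj (-((hsDiameter σ N / 2) • ω))] - g₀| ≤ δ)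
    (hK : ∫⁻ v : V3, ∫⁻ w : V3, ∫⁻ ω : Metric.sphere (0 : V3) 1,
        ENNReal.ofReal ⟪((ω : V3)), w - v⟫ *
          ENNReal.ofReal (localMaxwellian 1 θ 0 v * localMaxwellian 1 θ 0 w) *
          ENNReal.ofReal (‖v - w‖ ^ 2) ∂(volume : Measure V3).toSphere ≤ ENNReal.ofReal K) :
    let Stat : (T3 → V3 → V3 → V3 → ℝ≥0∞) → ℝ≥0∞ := fun Ψ =>
      ∫⁻ x : T3, ∫⁻ v : V3, ∫⁻ w : V3, ∫⁻ ω : Metric.sphere (0 : V3) 1,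
        ENNReal.ofReal (hsDiameter σ N ^ (Fintype.card (Fin 3) - 1) * ⟪((ω : V3)), w - v⟫) *
          ENNReal.ofReal (localMaxwellian 1 θ 0 v * localMaxwellian 1 θ 0 w) * Ψ x v w ω *
            ENNReal.ofReal (vcan (hsDiameter σ N) (N + 1)
              ![x + Literature.Analysis.FunctionSpaces.Torus.proj ((hsDiameter σ N / 2) • (ω : V3)),
                x + Literature.Analysis.FunctionSpaces.Torus.proj (-((hsDiameter σ N / 2) • (ω : V3)))])
        ∂(volume : Measure V3).toSphere
    let mark : ℝ → T3 → V3 → V3 → V3 → ℝ≥0∞ := fun c x v w n =>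
      ENNReal.ofReal (max (c * (‖v - w‖ ^ 2 *
        (ψ N s x v w n -
          ∫ ξ, ψ N s x v w
            (‖‖-(v - w)‖⁻¹ • (-(v - w)) + ‖ξ‖⁻¹ • ξ‖⁻¹ • (‖-(v - w)‖⁻¹ • (-(v - w)) + ‖ξ‖⁻¹ • ξ))
            ∂(stdGaussian V3)))) 0)
    Stat (mark 1) ≤ Stat (mark (-1)) +
        ENNReal.ofReal (4 * δ * hsDiameter σ N ^ (Fintype.card (Fin 3) - 1) * K) ∧
      Stat (mark (-1)) ≤ Stat (mark 1) +
        ENNReal.ofReal (4 * δ * hsDiameter σ N ^ (Fintype.card (Fin 3) - 1) * K) ∧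
      Stat (mark 1) ≤ ENNReal.ofReal ((g₀ + δ) * (2 * hsDiameter σ N ^ (Fintype.card (Fin 3) - 1) * K)) ∧
      Stat (mark (-1)) ≤
        ENNReal.ofReal ((g₀ + δ) * (2 * hsDiameter σ N ^ (Fintype.card (Fin 3) - 1) * K)) := by
  intro Stat mark
  -- the four factors on the product space `P = T3 × V3 × V3 × S²`
  set εk : ℝ := hsDiameter σ N ^ (Fintype.card (Fin 3) - 1) with hεk
  have hεk0 : 0 ≤ εk := pow_nonneg (hsDiameter_pos hσ N).le _
  have hWm := measurable_fluxWeight εk θ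
  have hΨpm := measurable_markPart (hψm N) s 1
  have hΨmm := measurable_markPart (hψm N) s (-1)
  have hVm := (measurable_vcan_dumbbell (hsDiameter σ N) (N + 1)).ennreal_ofReal
  haveI : SFinite ((volume : Measure V3).toSphere) := inferInstance
  haveI : SFinite ((volume : Measure V3).prod (volume : Measure V3).toSphere) := inferInstance
  haveI : SFinite ((volume : Measure V3).prod ((volume : Measure V3).prod
      (volume : Measure V3).toSphere)) := inferInstance
  -- the dumbbell correlation is within `δ` of `g₀` at every point of `P`
  have hVb : ∀ p : T3 × V3 × V3 × Metric.sphere (0 : V3) 1,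
      |vcan (hsDiameter σ N) (N + 1)
          ![p.1 + Literature.Analysis.FunctionSpaces.Torus.proj ((hsDiameter σ N / 2) • (p.2.2.2 : V3)),
            p.1 + Literature.Analysis.FunctionSpaces.Torus.proj (-((hsDiameter σ N / 2) • (p.2.2.2 : V3)))] -
        g₀| ≤ δ := fun p => hV p.1 p.2.2.2 (norm_eq_of_mem_sphere p.2.2.2)
  -- the centred mark is bounded by `2 |v - w|²`
  have hmk : ∀ (c : ℝ), |c| = 1 → ∀ (x : T3) (v w n : V3), mark c x v w n ≤ ENNReal.ofReal (2 * ‖v - w‖ ^ 2) := by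
    intro c hc x v w n
    refine ENNReal.ofReal_le_ofReal (max_le ?_ (by positivity))
    refine (le_abs_self _).trans ?_
    rw [abs_mul, hc, one_mul, abs_mul, abs_pow, abs_norm, mul_comm 2]
    refine mul_le_mul_of_nonneg_left ?_ (sq_nonneg _)
    have h1 := hψb N s x v w n
    have h2 := NearField.abs_integral_le_one (stdGaussian V3) (f := fun ξ => ψ N s x v w
      (‖‖-(v - w)‖⁻¹ • (-(v - w)) + ‖ξ‖⁻¹ • ξ‖⁻¹ • (‖-(v - w)‖⁻¹ • (-(v - w)) + ‖ξ‖⁻¹ • ξ)))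
      fun ξ => hψb N s x v w _
    exact (abs_sub _ _).trans (by linarith)
  -- product-space forms of the static functionals
  have eStat : ∀ c : ℝ, Stat (mark c) =
      ∫⁻ p, ENNReal.ofReal (εk * ⟪((p.2.2.2 : V3)), p.2.2.1 - p.2.1⟫) *
          ENNReal.ofReal (localMaxwellian 1 θ 0 p.2.1 * localMaxwellian 1 θ 0 p.2.2.1) *
          mark c p.1 p.2.1 p.2.2.1 p.2.2.2 *
          ENNReal.ofReal (vcan (hsDiameter σ N) (N + 1)
            ![p.1 + Literature.Analysis.FunctionSpaces.Torus.proj ((hsDiameter σ N / 2) • (p.2.2.2 : V3)),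
              p.1 + Literature.Analysis.FunctionSpaces.Torus.proj (-((hsDiameter σ N / 2) • (p.2.2.2 : V3)))])
        ∂((volume : Measure T3).prod ((volume : Measure V3).prod
          ((volume : Measure V3).prod (volume : Measure V3).toSphere))) := fun c =>
    lintegral_iter4_eq_prod ((hWm.mul (measurable_markPart (hψm N) s c)).mul hVm)
  -- the fibrewise centring identity, integrated: `∫ W Ψ⁺ = ∫ W Ψ⁻`
  have hcenIter : ∫⁻ x : T3, ∫⁻ v : V3, ∫⁻ w : V3, ∫⁻ ω : Metric.sphere (0 : V3) 1,
      ENNReal.ofReal (εk * ⟪((ω : V3)), w - v⟫) *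
        ENNReal.ofReal (localMaxwellian 1 θ 0 v * localMaxwellian 1 θ 0 w) * mark 1 x v w ω
        ∂(volume : Measure V3).toSphere =
      ∫⁻ x : T3, ∫⁻ v : V3, ∫⁻ w : V3, ∫⁻ ω : Metric.sphere (0 : V3) 1,
      ENNReal.ofReal (εk * ⟪((ω : V3)), w - v⟫) *
        ENNReal.ofReal (localMaxwellian 1 θ 0 v * localMaxwellian 1 θ 0 w) * mark (-1) x v w ω
        ∂(volume : Measure V3).toSphere := by
    refine lintegral_congr fun x => lintegral_congr fun v => lintegral_congr fun w => ?_
    have hfm : Measurable fun n : V3 => ψ N s x v w n :=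
      (hψm N).comp (measurable_const.prodMk (measurable_const.prodMk (measurable_const.prodMk
        (measurable_const.prodMk measurable_id))))
    have key := fibre_lintegral_cosFlux_mark_pos_eq_neg (g := v - w) (f := fun n => ψ N s x v w n) hfm
      (hψb N s x v w) hεk0
    simp only [lambertDir] at key
    have hl : ∀ ω : Metric.sphere (0 : V3) 1,
        ENNReal.ofReal (εk * ⟪((ω : V3)), w - v⟫) *
          ENNReal.ofReal (localMaxwellian 1 θ 0 v * localMaxwellian 1 θ 0 w) * mark 1 x v w ω =
        ENNReal.ofReal (localMaxwellian 1 θ 0 v * localMaxwellian 1 θ 0 w) *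
          (ENNReal.ofReal (εk * ⟪((ω : V3)), -(v - w)⟫) *
            ENNReal.ofReal (‖v - w‖ ^ 2 * (ψ N s x v w ω -
              ∫ ξ, ψ N s x v w (‖‖-(v - w)‖⁻¹ • (-(v - w)) + ‖ξ‖⁻¹ • ξ‖⁻¹ •
                (‖-(v - w)‖⁻¹ • (-(v - w)) + ‖ξ‖⁻¹ • ξ)) ∂(stdGaussian V3)))) := by
      intro ω
      show _ * _ * ENNReal.ofReal (max _ 0) = _
      rw [one_mul, ofReal_max_zero, neg_sub]
      ring
    have hr : ∀ ω : Metric.sphere (0 : V3) 1,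
        ENNReal.ofReal (εk * ⟪((ω : V3)), w - v⟫) *
          ENNReal.ofReal (localMaxwellian 1 θ 0 v * localMaxwellian 1 θ 0 w) * mark (-1) x v w ω =
        ENNReal.ofReal (localMaxwellian 1 θ 0 v * localMaxwellian 1 θ 0 w) *
          (ENNReal.ofReal (εk * ⟪((ω : V3)), -(v - w)⟫) *
            ENNReal.ofReal (-(‖v - w‖ ^ 2 * (ψ N s x v w ω -
              ∫ ξ, ψ N s x v w (‖‖-(v - w)‖⁻¹ • (-(v - w)) + ‖ξ‖⁻¹ • ξ‖⁻¹ •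
                (‖-(v - w)‖⁻¹ • (-(v - w)) + ‖ξ‖⁻¹ • ξ)) ∂(stdGaussian V3))))) := by
      intro ω
      show _ * _ * ENNReal.ofReal (max _ 0) = _
      rw [neg_one_mul, ofReal_max_zero, neg_sub]
      ring
    rw [lintegral_congr hl, lintegral_congr hr, lintegral_const_mul' _ _ ENNReal.ofReal_ne_top,
      lintegral_const_mul' _ _ ENNReal.ofReal_ne_top, key]
  have hcen : ∫⁻ p, ENNReal.ofReal (εk * ⟪((p.2.2.2 : V3)), p.2.2.1 - p.2.1⟫) *
          ENNReal.ofReal (localMaxwellian 1 θ 0 p.2.1 * localMaxwellian 1 θ 0 p.2.2.1) *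
          mark 1 p.1 p.2.1 p.2.2.1 p.2.2.2
        ∂((volume : Measure T3).prod ((volume : Measure V3).prod
          ((volume : Measure V3).prod (volume : Measure V3).toSphere))) =
      ∫⁻ p, ENNReal.ofReal (εk * ⟪((p.2.2.2 : V3)), p.2.2.1 - p.2.1⟫) *
          ENNReal.ofReal (localMaxwellian 1 θ 0 p.2.1 * localMaxwellian 1 θ 0 p.2.2.1) *
          mark (-1) p.1 p.2.1 p.2.2.1 p.2.2.2
        ∂((volume : Measure T3).prod ((volume : Measure V3).prod
          ((volume : Measure V3).prod (volume : Measure V3).toSphere))) :=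
    ((lintegral_iter4_eq_prod (hWm.mul hΨpm)).symm.trans hcenIter).trans
      (lintegral_iter4_eq_prod (hWm.mul hΨmm))
  -- the comparison flux: `∫ W Ψ⁺ ≤ 2 ε^k K`
  have hGm : Measurable fun p : T3 × V3 × V3 × Metric.sphere (0 : V3) 1 =>
      ENNReal.ofReal ⟪((p.2.2.2 : V3)), p.2.2.1 - p.2.1⟫ *
        ENNReal.ofReal (localMaxwellian 1 θ 0 p.2.1 * localMaxwellian 1 θ 0 p.2.2.1) *
        ENNReal.ofReal (‖p.2.1 - p.2.2.1‖ ^ 2) := by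
    have h1 : Measurable fun p : T3 × V3 × V3 × Metric.sphere (0 : V3) 1 =>
        ENNReal.ofReal (1 * ⟪((p.2.2.2 : V3)), p.2.2.1 - p.2.1⟫) *
          ENNReal.ofReal (localMaxwellian 1 θ 0 p.2.1 * localMaxwellian 1 θ 0 p.2.2.1) :=
      measurable_fluxWeight 1 θ
    simp only [one_mul] at h1
    exact h1.mul (((measurable_fst.comp measurable_snd).sub
      (measurable_fst.comp (measurable_snd.comp measurable_snd))).norm.pow_const 2).ennreal_ofReal
  have hB : ∫⁻ p, ENNReal.ofReal (εk * ⟪((p.2.2.2 : V3)), p.2.2.1 - p.2.1⟫) *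
          ENNReal.ofReal (localMaxwellian 1 θ 0 p.2.1 * localMaxwellian 1 θ 0 p.2.2.1) *
          mark 1 p.1 p.2.1 p.2.2.1 p.2.2.2
        ∂((volume : Measure T3).prod ((volume : Measure V3).prod
          ((volume : Measure V3).prod (volume : Measure V3).toSphere))) ≤
      ENNReal.ofReal (2 * εk) * ENNReal.ofReal K := by
    calc _ ≤ ∫⁻ p, ENNReal.ofReal (2 * εk) * (ENNReal.ofReal ⟪((p.2.2.2 : V3)), p.2.2.1 - p.2.1⟫ *
            ENNReal.ofReal (localMaxwellian 1 θ 0 p.2.1 * localMaxwellian 1 θ 0 p.2.2.1) *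
            ENNReal.ofReal (‖p.2.1 - p.2.2.1‖ ^ 2))
          ∂((volume : Measure T3).prod ((volume : Measure V3).prod
            ((volume : Measure V3).prod (volume : Measure V3).toSphere))) := by
          refine lintegral_mono fun p => ?_
          calc _ ≤ ENNReal.ofReal (εk * ⟪((p.2.2.2 : V3)), p.2.2.1 - p.2.1⟫) *
                ENNReal.ofReal (localMaxwellian 1 θ 0 p.2.1 * localMaxwellian 1 θ 0 p.2.2.1) *
                ENNReal.ofReal (2 * ‖p.2.1 - p.2.2.1‖ ^ 2) :=
                mul_le_mul' le_rfl (hmk 1 abs_one _ _ _ _)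
            _ = _ := by
                rw [ENNReal.ofReal_mul hεk0, ENNReal.ofReal_mul (by norm_num : (0 : ℝ) ≤ 2),
                  ENNReal.ofReal_mul (by norm_num : (0 : ℝ) ≤ 2)]
                ring
      _ = ENNReal.ofReal (2 * εk) * ∫⁻ p, ENNReal.ofReal ⟪((p.2.2.2 : V3)), p.2.2.1 - p.2.1⟫ *
            ENNReal.ofReal (localMaxwellian 1 θ 0 p.2.1 * localMaxwellian 1 θ 0 p.2.2.1) *
            ENNReal.ofReal (‖p.2.1 - p.2.2.1‖ ^ 2)
          ∂((volume : Measure T3).prod ((volume : Measure V3).prod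
            ((volume : Measure V3).prod (volume : Measure V3).toSphere))) :=
          lintegral_const_mul' _ _ ENNReal.ofReal_ne_top
      _ = ENNReal.ofReal (2 * εk) * ∫⁻ _x : T3, ∫⁻ v : V3, ∫⁻ w : V3, ∫⁻ ω : Metric.sphere (0 : V3) 1,
            ENNReal.ofReal ⟪((ω : V3)), w - v⟫ *
              ENNReal.ofReal (localMaxwellian 1 θ 0 v * localMaxwellian 1 θ 0 w) *
              ENNReal.ofReal (‖v - w‖ ^ 2) ∂(volume : Measure V3).toSphere := by
          rw [lintegral_iter4_eq_prod hGm]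
      _ ≤ ENNReal.ofReal (2 * εk) * ENNReal.ofReal K := by
          rw [lintegral_T3_const]
          exact mul_le_mul' le_rfl hK
  -- the abstract sandwich on the product space
  have S := sandwich ((volume : Measure T3).prod ((volume : Measure V3).prod
      ((volume : Measure V3).prod (volume : Measure V3).toSphere))) hg₀ hδ hVb
    (hWm.mul hΨpm) (hWm.mul hΨmm) hcen hB
  have hC : ENNReal.ofReal (2 * δ) * (ENNReal.ofReal (2 * εk) * ENNReal.ofReal K) =
      ENNReal.ofReal (4 * δ * εk * K) := by
    rw [← ENNReal.ofReal_mul (by positivity), ← ENNReal.ofReal_mul (by positivity)]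
    congr 1
    ring
  have hCf : ENNReal.ofReal (g₀ + δ) * (ENNReal.ofReal (2 * εk) * ENNReal.ofReal K) =
      ENNReal.ofReal ((g₀ + δ) * (2 * εk * K)) := by
    rw [← ENNReal.ofReal_mul (by positivity), ← ENNReal.ofReal_mul (by positivity)]
  rw [eStat 1, eStat (-1), ← hC, ← hCf]
  exact S
end EqCrux

end Summit.AtomisticToContinuum.HydrodynamicLimit.Theorems.ContactAngleEquidistributionSketch

end
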